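import Summits.BirchSwinnertonDyer.BirchSwinnertonDyer.Theorems.EisensteinPrimesMazurMCOnCellBTwistbackDefectSwapUp
import Summits.BirchSwinnertonDyer.Rank1Residual.X11b.TwistTransportTam
import Summits.BirchSwinnertonDyer.BirchSwinnertonDyer.Theorems.GoldfeldAllTwistsTwoConverseTwinAdditiveRootNumber
import Summits.BirchSwinnertonDyer.BirchSwinnertonDyer.Theorems.AdditiveBranchIMCGordTwoRankOneHeegnerKolyvaginItem
import HarnessLib

/-!
# Crux `PrintCFram.BottomClassIndexLawFiveLe` (stmt-BirchSwinnertonDyer-20372), line `eisenstein-resource-bdp-line`,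
# branch «genus-internal Heegner fields» of `stub_seedOffExc` (idea card rev 2, critic V#146/V#146b): THE RANK-ZERO
# DISPLAY AND THE TWIST-UP BRICK FOR EVERY DISCRIMINANT PARITY AT `p ≥ 5`

Width seat w3 g16 (prover-bsd-line-cfram-p1-w3-g16-0, 2026-08-29); helper `--supports stmt-BirchSwinnertonDyer-20372`;
theorems only (0 defs / 0 named facts / 0 sorry). It answers critic idea-crit-10 g5 V#146b (2) («check whether bsd-eis has
the display for even `d_K` — if not, −52 and −104 stay on the split-seed road») IN THE KERNEL: the display IS parity-free
at every prime `p ≥ 5`.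

* §1 `displaySwap_of_indexIdentityAt_of_five_le` — bsd-eis's CLASS-AGNOSTIC display
  `EisensteinPrimesMazurMCOnCellBTwistbackDisplay.displaySwap_of_indexIdentityAt` (LEAD bsd-line-x2-p1 g6) VERBATIM with the
  hypotheses `Odd (NumberField.discr K)` AND `NumberField.discr K < -4` DELETED and `p ≠ 2` strengthened to `5 ≤ p`. In that proof `d_K` odd enters at
  exactly one step, the Tamagawa comparison `ord_p ∏c(E^{(d_K)}) = ord_p ∏c(E)`
  (`X2.padicValNat_tamagawaProduct_twist_of_heegner_of_odd`); the tree already holds the parity-free comparison at `p ≥ 5`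
  (`X11b.padicValNat_tamagawaProduct_twist_of_heegner`, multr1-p2: at a prime `ℓ ∣ d_K` the twist is additive with
  `c_ℓ ≤ 4 < p`), and the other three steps (the swapped Gross–Zagier identity
  `TwistIdentity.padicValRat_add_eq_of_grossZagier_swap`, `Ш(E/K)[p^∞] ≅ Ш(E) ⊕ Ш(E^K)`, the torsion comparison
  `…_anyRank`) carry no parity hypothesis. So: for `W/ℚ` globally minimal of conductor `N` with `ord_{s=1} L(E,s) = 0`,
  `p ≥ 5`, `K` ANY imaginary quadratic field (no parity and no `d_K < −4` hypothesis: an odd prime dividing `w_K` is `3`,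
  `AdditiveBranchIMCGordTwoRankOne.HeegnerKolyvagin.eq_three_and_discr_eq_of_dvd_unitsTorsionOrder`), Heegner for `N`,
  `p` split, a datum `Dt` with
  `p ∤ c(Dt)` and its Heegner point `P`, a globally minimal model `Wd` of `E^{(d_K)}` with `ord_{s=1} L = 1`:
  `X11b.IndexIdentityAt W p K P` (granted `Ш(E/K)` finite) ⟹ the rank-zero display `defect_p(E) = −defect_p(Wd)`.
* §2 `bsdp_twist_of_indexIdentityAt_of_bsdp_rankZero` — §1 ∘ bsd-eis's class-agnostic brick
  `EisensteinPrimesMazurMCOnCellBTwistbackDefectSwapUp.bsdp_twist_of_displaySwap_of_bsdp_rankZero`: rank-zero `BSDp W p`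
  + the Heegner-index identity over `K` ⟹ `BSDp Wd p` at the rank-one twist, any parity of `d_K`.
* §3 `bsdp_twist_cm7_of_indexIdentityAt` — §2 at `(W, p, N) = (X₀(49) = cm7, 7, 49)`: the Heegner hypothesis for `49`
  IS «`7` split», `N_{X₀(49)} = 49` (`conductorNorm_cm7`); what the branch still owes is named in the binders —
  `BSDp cm7 7` and `cm7.analyticRank = 0` (print: Burungale–Flach 2024 Cor. 2 / Rubin, `L(49a1,1) ≠ 0`), a level-`49`
  datum with `7 ∤ c` (Manin; `X₀(49)` optimal, `c = 1`), and `hid : Finite Ш(X₀(49)/K) → X11b.IndexIdentityAt cm7 7 K P`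
  (the ideator's OPEN predicate `IndexIdentityAtCm7SevenOfLogUnit` fed by Kriz–Li's unit logarithm and the cell's
  regular-member Selmer count). With §3 the six `χ_{e*}(7) = +1` classes of LEAD g13 §4's `p = 7` window
  (`e* ∈ {−52, −83, −87, −104, −139, −143}`) are on ONE road; nothing distinguishes −52 = −4·13 and −104 = −8·13 any more.

HONEST FRAMING: bookkeeping only; nothing here proves BSD for any curve, the Heegner-index identity over `K`, or any
registered stub; `stub_seedOffExc` is untouched; the branch is the ideator's/critic's proposal and its adoption is the
LEAD's call. No summit statement is proved by this seat.

References: [CastellaEtAl2021] Thm. 5.3.1, (5.5)–(5.7); [GrossZagier1986] I.(6.5), V.§2; [Castella2018] (5.3);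
[JetchevSkinnerWan2017] §7.4.1 (eq:tamK); [Miller2011LMS] Def. 1.1; [KrizLi2019] Thm. 1.20.
-/

set_option autoImplicit false

-- `Summit.BirchSwinnertonDyer.BirchSwinnertonDyer.…`: the summit and its single sub-problem share a name.
set_option linter.dupNamespace false

noncomputable section

open scoped Classical MatrixGroups ModularForm

open CongruenceSubgroup WeierstrassCurve NumberField
  Literature.NumberTheory.EllipticCurves
  Literature.NumberTheory.EllipticCurves.ModularForms
  Literature.NumberTheory.QuadraticFields
  Literature.NumberTheory.EllipticCurves.KrizLi2019
  Literature.NumberTheory.EllipticCurves.Rank1Residual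
  Literature.NumberTheory.EllipticCurves.Rank1Residual.Typed
  Literature.NumberTheory.EllipticCurves.Wuthrich2014
  Literature.NumberTheory.EllipticCurves.SteinWuthrich2013
  Literature.NumberTheory.EllipticCurves.GreenbergVatsal2000
  Summit.BirchSwinnertonDyer.Rank1Residual
  Summit.BirchSwinnertonDyer.BirchSwinnertonDyer.Theses
  Summit.BirchSwinnertonDyer.BirchSwinnertonDyer.Theorems.Rank1ResidualX1RankZeroTwist

namespace Summit.BirchSwinnertonDyer.BirchSwinnertonDyer.Theorems.PrintCFram.GenusInternal

/-! ## §1. The rank-zero display from the Heegner-index identity over `K` — any parity of `d_K`, `p ≥ 5` -/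

/-- **The rank-zero display at one Heegner datum from the Heegner-index identity over `K`, for EVERY parity of
`d_K` at `p ≥ 5`.** Data: `W/ℚ` globally minimal of conductor `N`, `ord_{s=1} L(E,s) = 0`, `5 ≤ p`; `K` imaginary
quadratic — ANY discriminant: odd or even, and `d_K ∈ {−3, −4}` allowed (`p ≥ 5 ∤ w_K ∈ {2, 4, 6}`) —, Heegner hypothesis
for `N`, `p` split; `Dt` a parametrisation datum of level `N`
with `p ∤ c(Dt)`, `H` a Heegner datum, `P ∈ E(K)` its Heegner point; `Wd` a globally minimal model of `E^{(d_K)}` with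
`ord_{s=1} L = 1`; `q = L(E,1)/Ω_E`, `q_d = L'(Wd,1)/(Ω·Reg)`. Inputs by name: Gross–Zagier (`hGZ`), Kolyvagin (`hKo`),
GZK, modularity. If `X11b.IndexIdentityAt W p K P` holds (granted `Ш(E/K)` finite), then
`ord_p q − (ord_p #Ш(E) + ord_p ∏c(E) − 2 ord_p #E(ℚ)_tors) = −(ord_p q_d − (ord_p #Ш(Wd) + ord_p ∏c(Wd) − 2 ord_p #Wd(ℚ)_tors))`.
Proof: bsd-eis's `displaySwap_of_indexIdentityAt` line by line — `TwistIdentity.padicValRat_add_eq_of_grossZagier_swap`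
(`ord_p q + ord_p q_d = 2 ord_p I − 2 ord_p c − 2 ord_p #E(K)_tors`), the identity (`2 ord_p ∏c(E) + ord_p #Ш(E/K) = 2 ord_p I`),
the odd-`p` parts under `K/ℚ` of `Ш` and torsion — with the ONE parity-dependent step, the Tamagawa comparison, taken
from multr1-p2's parity-free `X11b.padicValNat_tamagawaProduct_twist_of_heegner` (`p ≥ 5`: at `ℓ ∣ d_K` the twist is
additive, `c_ℓ ≤ 4`). [cite: CastellaEtAl2021, proof of Thm. 5.3.1, (5.5)–(5.7)]
[cite: GrossZagier1986, I.(6.5) and V.§2 (pp. 310–312)] [cite: Castella2018, (5.3) (p. 12)]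
[cite: JetchevSkinnerWan2017, §7.4.1 (eq:tamK) (pp. 29–31)] -/
theorem displaySwap_of_indexIdentityAt_of_five_le
    (W : WeierstrassCurve ℚ) [W.IsElliptic] [W.IsGloballyMinimal] (p : ℕ) [Fact p.Prime]
    (N : ℕ) [NeZero N] (K : Type) [Field K] [NumberField K]
    (Dt : ModularParametrizationData W N) (H : HeegnerDatum N (NumberField.discr K)) (ι : K →+* ℂ)
    (P : (W.baseChange K).toAffine.Point)
    (hGZ : gross_zagier N W K) (hKo : kolyvagin N W K)
    (hGZK : rank_eq_analyticRank_of_analyticRank_le_one) (hmod : hasEntireLFunction_rat)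
    (hK : IsImaginaryQuadratic K)
    (hN : W.conductorNorm ℤ = N) (hHN : SatisfiesHeegnerHypothesis N K)
    (hHp : SatisfiesHeegnerHypothesis p K)
    (hP : WeierstrassCurve.Affine.Point.map ι.toRatAlgHom P = heegnerPointComplex Dt H)
    (hp5 : 5 ≤ p) (hc : ¬ (p : ℤ) ∣ Dt.c) (hr : W.analyticRank = 0)
    (Wd : WeierstrassCurve ℚ) [Wd.IsElliptic] [Wd.IsGloballyMinimal]
    (hWd : ∃ C : VariableChange ℚ, C • Wd = W.quadraticTwist (NumberField.discr K : ℚ))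
    (hrd : Wd.analyticRank = 1)
    (hid : Finite (W.baseChange K).sha → X11b.IndexIdentityAt W p K P)
    (q qd : ℚ) (hq : W.entireLFunction 1 / (W.realPeriodRat : ℂ) = (q : ℂ))
    (hqd : Wd.leadingLCoeff / ((Wd.realPeriodRat * Wd.regulator : ℝ) : ℂ) = (qd : ℂ)) :
    padicValRat p q - ((padicValNat p W.shaOrder : ℤ) + padicValNat p W.tamagawaProduct -
        2 * padicValNat p W.torsionOrder) =
      -(padicValRat p qd - ((padicValNat p Wd.shaOrder : ℤ) + padicValNat p Wd.tamagawaProduct -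
        2 * padicValNat p Wd.torsionOrder)) := by
  have hpp : p.Prime := Fact.out
  have hp2 : p ≠ 2 := by omega
  haveI hEK : (W.baseChange K).IsElliptic := isElliptic_baseChange' W K
  have h2 : Module.finrank ℚ K = 2 := hK.1
  have hHN' : SatisfiesHeegnerHypothesis (W.conductorNorm ℤ) K := by rw [hN]; exact hHN
  have hD0 : (NumberField.discr K : ℚ) ≠ 0 := by exact_mod_cast NumberField.discr_ne_zero K
  haveI hEt : (W.quadraticTwist (NumberField.discr K : ℚ)).IsElliptic := W.isElliptic_quadraticTwist hD0
  -- the inverse change of variables `Cd • E^{(d_K)} = Wd`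
  obtain ⟨C, hC⟩ := hWd
  set Cd : VariableChange ℚ := C⁻¹ with hCd_def
  have hCd : Cd • W.quadraticTwist (NumberField.discr K : ℚ) = Wd := by rw [← hC, inv_smul_smul]
  -- `p ∤ d_K` (split), `p ∤ w_K = 2`, `ord_p u(Cd) = 0`
  have hpd : ¬ (p : ℤ) ∣ NumberField.discr K := not_dvd_discr_of_split hK hpp hp2 hHp
  -- `p ∤ w_K` for EVERY imaginary quadratic `K` once `p ≥ 5` (an odd `p ∣ w_K` is `3`)
  have hμ : ¬ p ∣ Units.torsionOrder K := fun h => by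
    obtain ⟨h3, -⟩ :=
      AdditiveBranchIMCGordTwoRankOne.HeegnerKolyvagin.eq_three_and_discr_eq_of_dvd_unitsTorsionOrder
        hK.1 hpp hp2 h
    omega
  have hu : padicValRat p (Cd.u : ℚ) = 0 :=
    AdditivePotMult.padicValRat_u_eq_zero_of_twist_minimal_of_split W p K hK hHp Cd hCd
  ---------------------------------------------------------------- Kolyvagin: `Ш(E/K)` finite
  have hLt' : (W.quadraticTwist (NumberField.discr K : ℚ)).entireLFunction = Wd.entireLFunction := by
    rw [← hCd, entireLFunction_smul]
  have hL0d : Wd.entireLFunction 1 = 0 := entireLFunction_one_eq_zero_of_analyticRank_eq_one hrd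
  obtain ⟨-, hderivd⟩ := leadingLCoeff_eq_deriv_of_analyticRank_eq_one hrd
  have hLt0 : (W.quadraticTwist (NumberField.discr K : ℚ)).entireLFunction 1 = 0 := by
    rw [hLt']; exact hL0d
  have hprod : LDerivEK W K = W.entireLFunction 1 * deriv Wd.entireLFunction 1 := by
    rw [AdditivePotMult.lDerivEK_eq_mul_deriv W K hmod hLt0, hLt']
  have hLW : W.entireLFunction 1 ≠ 0 := (W.analyticRank_eq_zero_iff_holds (hmod W)).1 hr
  have hLK : LDerivEK W K ≠ 0 := by
    rw [hprod]; exact mul_ne_zero hLW hderivd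
  have hPH : IsHeegnerPoint N W K P := ⟨Dt, H, ι, hP⟩
  have hPinf : ¬ IsOfFinAddOrder P :=
    (lDerivEK_ne_zero_iff_not_isOfFinAddOrder W N K hGZ hK hHN hPH).mp hLK
  obtain ⟨-, hShaK⟩ := hKo hK hHN hPH hPinf
  haveI hfinK : Finite (W.baseChange K).sha := hShaK
  haveI hfinW : Finite W.sha := Literature.NumberTheory.EllipticCurves.shaFinite_of_baseChange W K hShaK
  obtain ⟨-, hShad⟩ := hGZK Wd (by omega)
  haveI hfinSd : Finite Wd.sha := hShad
  ---------------------------------------------------------------- the identity over `K`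
  have hKL := hid hfinK
  unfold X11b.IndexIdentityAt at hKL
  ---------------------------------------------------------------- (5.6) `p`-adically, ranks exchanged
  have h6 := TwistIdentity.padicValRat_add_eq_of_grossZagier_swap W p N K Dt H ι P hGZ hKo hGZK hmod hK
    hHN hP hp2 hμ hr Wd Cd hCd hu hrd q qd hq hqd
  ---------------------------------------------------------------- the odd parts under `K/ℚ`
  -- `Ш`: `v_p(#Ш(E/K)) = v_p(#Ш(E)) + v_p(#Ш(E^K))`
  have hsha : padicValNat p (W.baseChange K).shaOrder =
      padicValNat p W.shaOrder + padicValNat p Wd.shaOrder := by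
    have hcard := card_primaryComponent_sha_baseChange_quadratic_of_odd_of_finite W K h2 Wd
      ⟨Cd, hCd⟩ (W.baseChange K) ⟨1, one_smul _ _⟩ p hp2
    rw [WeierstrassCurve.shaOrder, WeierstrassCurve.shaOrder, WeierstrassCurve.shaOrder,
      ← (Nat.pow_right_injective hpp.two_le).eq_iff, pow_add,
      ← natCard_primaryComponent_eq_pow_padicValNat p, ← natCard_primaryComponent_eq_pow_padicValNat p,
      ← natCard_primaryComponent_eq_pow_padicValNat p]
    exact hcard
  -- torsion: `v_p(#E(K)_tors) = v_p(#E(ℚ)_tors) + v_p(#E^K(ℚ)_tors)`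
  obtain ⟨θ, c, hθ, hcθ⟩ := Quadratic.exists_sq_eq_algebraMap (F := ℚ) (K := K) h2
  obtain ⟨qq, hqq, hdq⟩ := NumberField.exists_discr_eq_mul_sq h2 hθ hcθ
  have htors : padicValNat p (W.baseChange K).torsionOrder =
      padicValNat p W.torsionOrder + padicValNat p Wd.torsionOrder :=
    AdditivePotMult.padicValNat_torsionOrder_baseChange_quadratic_anyRank W K h2 hθ hcθ hqq hdq Wd
      ⟨Cd, hCd⟩ p hp2
  -- Tamagawa: `v_p(∏c(E^K)) = v_p(∏c(E))` — PARITY-FREE at `p ≥ 5` (X11b transport (d))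
  have htam : padicValNat p Wd.tamagawaProduct = padicValNat p W.tamagawaProduct :=
    X11b.padicValNat_tamagawaProduct_twist_of_heegner W p hp5 K hK hHN' Cd hCd
  -- Manin constant prime to `p`
  have hvc : padicValInt p Dt.c = 0 := padicValInt.eq_zero_of_not_dvd hc
  ---------------------------------------------------------------- combine
  rw [hvc] at h6
  omega

/-! ## §2. The twist-up brick: rank-zero `BSDp` + the Heegner-index identity over `K` ⟹ `BSDp` at the rank-one twist -/

/-- **Rank-zero `BSD(E,p)` + the Heegner-index identity over `K` ⟹ `BSD(Wd,p)` at the rank-one twist, ANY parity of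
`d_K` (`p ≥ 5`).** Data as in §1, plus `BSDp W p` and Gross–Zagier I.(7.3) (`hGZ73`, rationality of `L'(Wd,1)/(Ω·Reg)`).
Conclusion: Miller's `BSDp Wd p` for the globally minimal model `Wd` of `E^{(d_K)}` of analytic rank one. Proof: §1 gives
the swapped display for every pair of rational values `(q, q_d)`, and bsd-eis's class-agnostic brick
`EisensteinPrimesMazurMCOnCellBTwistbackDefectSwapUp.bsdp_twist_of_displaySwap_of_bsdp_rankZero` runs it upwards.
CONDITIONAL on the named facts in the binders and on `hid`. [cite: CastellaEtAl2021, Thm. 5.3.1 and (5.5)–(5.7)]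
[cite: Miller2011LMS, Def. 1.1 (arXiv:1010.2431 p. 3)] [cite: GrossZagier1986, Thm. I.(7.3)] -/
theorem bsdp_twist_of_indexIdentityAt_of_bsdp_rankZero
    (W : WeierstrassCurve ℚ) [W.IsElliptic] [W.IsGloballyMinimal] (p : ℕ) [Fact p.Prime]
    (N : ℕ) [NeZero N] (K : Type) [Field K] [NumberField K]
    (Dt : ModularParametrizationData W N) (H : HeegnerDatum N (NumberField.discr K)) (ι : K →+* ℂ)
    (P : (W.baseChange K).toAffine.Point)
    (hGZ : gross_zagier N W K) (hKo : kolyvagin N W K)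
    (hGZK : rank_eq_analyticRank_of_analyticRank_le_one) (hmod : hasEntireLFunction_rat)
    (hGZ73 : GrossZagier1986_thm_I_7_3)
    (hK : IsImaginaryQuadratic K)
    (hN : W.conductorNorm ℤ = N) (hHN : SatisfiesHeegnerHypothesis N K)
    (hHp : SatisfiesHeegnerHypothesis p K)
    (hP : WeierstrassCurve.Affine.Point.map ι.toRatAlgHom P = heegnerPointComplex Dt H)
    (hp5 : 5 ≤ p) (hc : ¬ (p : ℤ) ∣ Dt.c) (hr : W.analyticRank = 0) (hB : BSDp W p)
    (Wd : WeierstrassCurve ℚ) [Wd.IsElliptic] [Wd.IsGloballyMinimal]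
    (hWd : ∃ C : VariableChange ℚ, C • Wd = W.quadraticTwist (NumberField.discr K : ℚ))
    (hrd : Wd.analyticRank = 1)
    (hid : Finite (W.baseChange K).sha → X11b.IndexIdentityAt W p K P) : BSDp Wd p :=
  EisensteinPrimesMazurMCOnCellBTwistbackDefectSwapUp.bsdp_twist_of_displaySwap_of_bsdp_rankZero hmod hGZK hGZ73
    W p hr hB Wd hrd
    (fun q qd hq hqd =>
      displaySwap_of_indexIdentityAt_of_five_le W p N K Dt H ι P hGZ hKo hGZK hmod hK hN hHN hHp hP hp5 hc
        hr Wd hWd hrd hid q qd hq hqd)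

/-! ## §3. The branch's arrow at `(X₀(49), 7)`: the six `χ_{e*}(7) = +1` window classes on one road -/

/-- **`BSD(W,7)` for the rank-one twist `W` of `X₀(49)` by a Heegner field `K` of ANY discriminant parity, from
`BSD(49a1,7)` in rank zero and the `7`-part of the Heegner-index identity over `K`.** For `K` imaginary quadratic with
the Heegner hypothesis for `49` (i.e. `7` split in `K` — so also the Heegner hypothesis for `7`; ANY `d_K`, `ℚ(√−3)` included), a
level-`49` parametrisation datum `Dt` of `X₀(49) = cm7` with `7 ∤ c(Dt)`, a Heegner datum `H`, the Heegner point
`P ∈ X₀(49)(K)`, and ANY globally minimal model `Wd` of `X₀(49)^{(d_K)}` with `ord_{s=1} L(Wd,s) = 1`: granted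
Gross–Zagier and Kolyvagin for `(49, cm7, K)`, GZK, modularity, Gross–Zagier I.(7.3), `cm7.analyticRank = 0` and
`BSDp cm7 7` (print: `L(49a1,1) ≠ 0`; Burungale–Flach 2024 Cor. 2), and
`hid : Finite Ш(X₀(49)/K) → X11b.IndexIdentityAt cm7 7 K P` — **`BSDp Wd 7`**. This is §2 at `(W,p,N) = (cm7,7,49)`
with `N_{X₀(49)} = 49` (`conductorNorm_cm7`) and the Heegner hypothesis for `7` read off the one for `49`. It puts
−52 = −4·13 and −104 = −8·13 on the same road as −83, −87, −139, −143 (LEAD g13 §4, `p = 7` window, `χ_{e*}(7) = +1`).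
Not BSD: CONDITIONAL on `hid` (the branch's OPEN piece) and the named facts. [cite: KrizLi2019, Thm. 1.20 (pp. 7–8)]
[cite: CastellaEtAl2021, Thm. 5.3.1] [cite: BurungaleFlach2024, Cor. 2] [cite: Miller2011LMS, Def. 1.1] -/
theorem bsdp_twist_cm7_of_indexIdentityAt
    (K : Type) [Field K] [NumberField K]
    (Dt : ModularParametrizationData cm7 49) (H : HeegnerDatum 49 (NumberField.discr K)) (ι : K →+* ℂ)
    (P : (cm7.baseChange K).toAffine.Point)
    (hGZ : gross_zagier 49 cm7 K) (hKo : kolyvagin 49 cm7 K)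
    (hGZK : rank_eq_analyticRank_of_analyticRank_le_one) (hmod : hasEntireLFunction_rat)
    (hGZ73 : GrossZagier1986_thm_I_7_3)
    (hK : IsImaginaryQuadratic K) (hH : SatisfiesHeegnerHypothesis 49 K)
    (hP : WeierstrassCurve.Affine.Point.map ι.toRatAlgHom P = heegnerPointComplex Dt H)
    (hc : ¬ (7 : ℤ) ∣ Dt.c) (hr : cm7.analyticRank = 0) (hB : BSDp cm7 7)
    (Wd : WeierstrassCurve ℚ) [Wd.IsElliptic] [Wd.IsGloballyMinimal]
    (hWd : ∃ C : VariableChange ℚ, C • Wd = cm7.quadraticTwist (NumberField.discr K : ℚ))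
    (hrd : Wd.analyticRank = 1)
    (hid : Finite (cm7.baseChange K).sha → X11b.IndexIdentityAt cm7 7 K P) : BSDp Wd 7 := by
  haveI : Fact (Nat.Prime 7) := ⟨by norm_num⟩
  have hH7 : SatisfiesHeegnerHypothesis 7 K := hH.of_dvd (by norm_num)
  exact bsdp_twist_of_indexIdentityAt_of_bsdp_rankZero cm7 7 49 K Dt H ι P hGZ hKo hGZK hmod hGZ73 hK
    GoldfeldGoodTwists.conductorNorm_cm7 hH hH7 hP (by norm_num) (by exact_mod_cast hc) hr hB Wd hWd hrd hid

end Summit.BirchSwinnertonDyer.BirchSwinnertonDyer.Theorems.PrintCFram.GenusInternal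

end
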